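import Summits.QuantumFields.BalabanUV.Beta.GAN24.EdgePotentialAxialGauge

/-!
# `BalabanUV.Beta.GAN24.GaugeReadExitWard` — binder row G-an2-4 ∕ (CONV-C), the (S) row of RULING R-gan24p1-g27-1 B (viii), the Ward-type half (W-γ), EXIT⊗EXIT class, jb = 0:
# **THE (γ) EXIT⊗EXIT CHARGE OF A SLOT IS `2·cE` TIMES ITS END-POINT (α⁺) CHARGE — `Q^γ_{αβ}(e; y) = 2·cE·V⁺_{αβ}(e; y)`, EVERY `α ≠ β`, EVERY slot `e = (ν,y′)`, EVERY label `y`,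
# EVERY in-block root** — ENGINE E-leaf06-g46-1 (M1) ⨾ (M2) ⨾ the (α⁺) value split, AS ONE THEOREM; in the joint (S)-row form `(−½cH_0)·Q^γ = ε·V⁺` this is `ε = −cE·cH_0` (`= −1` at the
# engine's pins `cE = Lc^{d+1}`, `cH_0 = Lc^{−(d+1)}`; ENGINE E-leaf06-g46-1 (M1) ∕ (M2): the (γ) and the (α⁺) reads of a slot both equal `R(e)` there)
# (G-an2-4 formalisation swarm → CRUX TEAM (2), seat `b2b-balaban-gan24-formalise-leaf-06` = the (γ) hand, gen 47, INTENT 3 FILE F)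

NOT IN PRINT; OUR BOOKKEEPING ([folklore] BY NAME over FILE E `EdgePotentialAxialGauge.gaugeRead_exitPairing_edgePotential` ((M1)), g46 INTENT 3
`EdgePotentialColumnOrthogonal.edgePotential_orthogonal_colH` ((M2)), leaf-02 g56 ∕ g57 `WilsonLetterFaceCharge.tsum_exitFace_wilsonA_exitFace_eq_neg_quarter_curvAdj`,
`FaceChargeCurlResummation.curv_faceForm`, `SrecExitChargeLevelZero.tsum_exitFace_tsum_exitFace_hessFFAt_eq_zero`, g46 `EdgePlaquettePotential` (`wedge_blk_eq`, `curvAdj_curv_edgePotential`,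
`abs_edgePotential_le_one`), FILE A `CombFreeGaugeLegCharges` (`hasSum_prod_of_support`, the two finite-support vanishing lemmas, `abs_curvAdj_curv_le`), g45 `GaugeReadLabelSums.abs_read_le`,
`GaugeReadChargeComb.exists_vertexFamily_combResponse`, an2's `SecondOrderSplitDecay.summable_colH_mul_bdd`; 0 `def`, 0 cited fact, 0 `def … : Prop`, 0 sorry).  HONEST FRAMING (cell contract,
verbatim): «discharging `BetaPertH` makes Bałaban's UV stability UNCONDITIONAL — a real constructive-QFT result; it is NOT the continuum limit and NOT the Clay problem.»  HONEST DEPENDENCY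
(verbatim): «continuum YM on T⁴ ⇐ BetaPertH ∧ nine spine estimates (0/9 proved); BetaPertH ⇐ (D1) ∧ (D4) ∧ CAP+tail; G-an2-4 gates asym, D1 and NE2/3/4.»
THE OBJECTS (generic `d`, in-block root `ρ = toSite r`, `r ∈ box (d+1) Lc`; `G₀ = coDressKBmAt ρ Lc (KInvStep Lc 0)`, `S₀ = SpureRecAt d Lc ρ cE cVH cΛ 0`, `M₀ = M1At d Lc ρ cΛ 0`; slot
`e = (ν,y′)`, label `y`; `A(e) = G₀ ∘ dM G₀ Lc S₀ M₀ ν y′` — the literal (γ) response of `GaugeReadChargeComb`; the exit⊗exit weight `ω(x,z) = 𝟙[x_α % Lc = Lc−1]·𝟙[z_β % Lc = Lc−1]` read in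
the channel `(inl α, inl β)`; the edge potential `m̃_αβ` of g46 `EdgePlaquettePotential`, written inline; all weights, charges and values are spelled out — no `def`).
* §1 `curvAdj_curv_faceForm_eq_two_mul` (`d*d(leaf-02's face form dψ_β⊙(ψ_α+ψ_α⁺)) = 2·d*d m̃_αβ`; road-P2 g42's `ChargeTowerInduction.curvAdj_curv_faceForm_eq_edgePotential` is the same
  junction with a scalar at a general scale — ours is the `L = Lc` instance in the shape consumed below), **`tsum_prod_exit_spureRecAt_zero`** (the exit⊗exit charge of the level-0 PURE S
  table in the product currency: `Σ'_{(x,z)} ω·S₀ κ u x z (inl α)(inl β) = −(cE∕2)·((d*d)m̃_αβ)_κ(u)`, any root offset; leaf-02's PART B `SrecChargeBlockPotentials.tsum_prod_exitWt_srecAt_zero` is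
  the block-weighted FULL-S analogue), **`tsum_prod_exit_M1At_zero`** (the M₁ table carries no exit⊗exit charge in an `(inl,inl)` channel).
* §2 **`gaugeCharge_exit_eq_two_mul_cE_mul_rotatedVertexEnd`** — THE IDENTITY.  LEFT: the (γ) ω-charge of the slot, i.e. the value of g45 `GaugeReadChargeProfile.hasSum_weighted_gaugeSup` at
  `A(e)`, `gaugeWt Lc y`, `ω`: `Σ_κ Σ'_u w_κ(u)·C_S(κ,u) + Σ_ρ′ Σ'_w w′_ρ′(w)·C_M(ρ′,w)` (`w_κ(u) = Σ'_{x₂} Σ_κ₂ A(e) u x₂ (inl κ)(inl κ₂)·gaugeWt Lc y κ₂ x₂`, `w′` the `inr` row at `Lc•w`,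
  `C_S`, `C_M` the ω-charges of `S₀`, `M₀`).  RIGHT: `2·cE` times the END-POINT (α⁺) ω-charge in road-P2's value form (`WardResidualRotatedVertexInversion.hasSum_weighted_rotatedVertexEnd_comb`
  read at level 0): `½·(Σ_κ Σ'_u colH G₀ Lc ν y′ κ u·(½𝟙[y′+e_ν = y] − ½𝟙[blk(u+e_κ) = y])·C_S(κ,u) + Σ_ρ′ Σ'_w colM G₀ Lc ν y′ ρ′ w·(½𝟙[y′+e_ν = y] − ½𝟙[w+e_ρ′ = y])·C_M(ρ′,w))`.
  PROOF: both sides equal `(cE²∕4)·R_y(e)`, `R_y(e) = Σ'_t Σ_l 1_{B(y)}(t+e_l)·colH G₀(e) l t·((d*d)m̃_αβ)_l(t)` — the left by §1 and (M1), the right by §1, (M2) (the slot-constant half of the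
  end-point weight pairs `(d*d)m̃` with the bare column: zero) and the block half (`= ½R`); `C_M ≡ 0`; summabilities from `abs_read_le` ∕ `exists_vertexFamily_combResponse` (left) and
  `summable_colH_mul_bdd` (right); the two infinite sums are identified through `HasSum.unique`, never by rewriting under the binder.
* §3 **`tsum_sum_exitCharge_mul_colH_eq_zero_levelZero`** ∕ **`sum_tsum_colH_mul_exitCharge_eq_zero_levelZero`** — (M1) ⨾ (M2) AT LEVEL 0 IN road-P2 g42's `ChargeTowerExitOrthogonal` §2
  SHAPE: `Σ'_u Σ_κ C_S(κ,u)·colH G₀ Lc ν y′ κ u = 0` and `Σ_κ Σ'_u colH G₀ Lc ν y′ κ u·C_S(κ,u) = 0` (§1 ⨾ g46 `edgePotential_orthogonal_colH`); with road-P2's levels `j+1`: EVERY level.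
READING.  This is the jb = 0 member of road-P2's (W-γ) exit programme (`ChargeTowerInduction` ∕ `ChargeTowerExitOrthogonal` carry the levels `j+1`); it converts ENGINE (M1)–(M3) into the
single statement the (S) row consumes at level 0, with the (S)-row constant DISPLAYED (`ε = −cE·cH_0`).  Asserts NO value of any resolvent column; NOTHING of (W-γ) at levels ≥ 1 ∕ (INV) ∕
(S) ∕ (Q-R) ∕ «T2Shape» ∕ (hW, hWall) discharged beyond this identity; NEVER «G-an2-4 closed» as (CONV-C); NOT D1, NOT `BetaPertH`, NOT continuum, NOT Clay.  2026-08-22; no existing file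
touched.
-/

noncomputable section

open Finset
open scoped BigOperators
open Literature.MathematicalPhysics.QuantumFieldTheory
open Literature.MathematicalPhysics.QuantumFieldTheory.Balaban1983to89
open Literature.MathematicalPhysics.QuantumFieldTheory.Balaban1983to89.Beta
open ExpKernelCalculus (Site MKer Decays comp)
open AffineAveraging (Form1 Form2 box toSite unitVec unitVec_apply dz curv curvAdj)
open AveragingContours (blk)
open OneStepResolventKernel (Fib)
open OneStepKernelFamily (KInvStep colH)
open SecondOrderResponse (colM dM)
open StepJetData (wilsonA)
open AveragingHessianKernelsRooted (hessFFAt)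
open AveragingWardStencils (b6UnitVec_eq)
open Summit.QuantumFields.BalabanUV.Beta.AxialDressingRooted (coDressKBmAt decays_coDressKBmAt_KInvStep one_le_of_neZero cube)
open Summit.QuantumFields.BalabanUV.Beta.SpineRooted (SpureRecAt M1At)
open Summit.QuantumFields.BalabanUV.Beta.KernelWardRelative (gaugeWt)
open Summit.QuantumFields.BalabanUV.Beta.LinearGaugeVH (nearBox)
open Summit.QuantumFields.BalabanUV.Beta.SecondOrderSplitDecay (summable_colH_mul_bdd)
open Summit.QuantumFields.BalabanUV.Beta.GAN24.WilsonLetterFlatCharges (spureRecAt_zero_inl_inl)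
open Summit.QuantumFields.BalabanUV.Beta.GAN24.WilsonLetterFaceCharge (tsum_exitFace_wilsonA_exitFace_eq_neg_quarter_curvAdj)
open Summit.QuantumFields.BalabanUV.Beta.GAN24.FaceChargeCurlResummation (curv_faceForm)
open Summit.QuantumFields.BalabanUV.Beta.GAN24.EdgePlaquettePotential (wedge_blk_eq curvAdj_curv_edgePotential abs_edgePotential_le_one)
open Summit.QuantumFields.BalabanUV.Beta.GAN24.EdgePotentialColumnOrthogonal (edgePotential_orthogonal_colH)
open Summit.QuantumFields.BalabanUV.Beta.GAN24.SrecExitChargeLevelZero (tsum_exitFace_tsum_exitFace_hessFFAt_eq_zero)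
open Summit.QuantumFields.BalabanUV.Beta.GAN24.CombFreeGaugeLegCharges (hasSum_prod_of_support wilsonA_inl_inl_eq_zero_of_not_mem hessFFAt_inl_inl_eq_zero_of_not_mem₂
  abs_curvAdj_curv_le)
open Summit.QuantumFields.BalabanUV.Beta.GAN24.EdgePotentialAxialGauge (gaugeRead_exitPairing_edgePotential)
open Summit.QuantumFields.BalabanUV.Beta.GAN24.GaugeReadLabelSums (abs_read_le)
open Summit.QuantumFields.BalabanUV.Beta.KernelWardResidual (abs_gaugeWt_le_one)
open Summit.QuantumFields.BalabanUV.Beta.GAN24.GaugeReadChargeComb (exists_vertexFamily_combResponse)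
open B12Sec2to5 (l1)
open ExpKernelCalculus (Zl summable_exp_shift')

namespace Summit.QuantumFields.BalabanUV.Beta.GAN24.GaugeReadExitWard

variable {d : ℕ}

/-! ## §1 The exit⊗exit slot charges of the level-0 tables in the product currency -/

/-- NOT IN PRINT; OUR BOOKKEEPING.  **THE MAXWELL IMAGE OF leaf-02's FACE FORM IS TWICE THAT OF THE EDGE POTENTIAL**: `d*d(dzψ_β ⊙ (ψ_α + ψ_α⁺)) = 2·d*d m̃_αβ` (`α ≠ β`, `1 ≤ Lc`;
leaf-02's `curv_faceForm`, g46's `wedge_blk_eq` ∕ `curvAdj_curv_edgePotential`). -/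
theorem curvAdj_curv_faceForm_eq_two_mul {Lc : ℕ} (hLc : 1 ≤ Lc) {α β : Fin (d + 1)} (hab : α ≠ β) (κ : Fin (d + 1)) (u : Site (d + 1)) :
    curvAdj (curv (fun β' z => dz (fun w : Fin (d + 1) → ℤ => ((w β / (Lc : ℤ) : ℤ) : ℝ)) β' z
        * ((((z α / (Lc : ℤ) : ℤ) : ℝ)) + (((z + B6BondElimination.unitVec β') α / (Lc : ℤ) : ℤ) : ℝ)))) κ u
      = 2 * curvAdj (curv (fun β' z => ((Lc : ℝ) ^ 2)⁻¹ * ((((z + unitVec β') β % (Lc : ℤ) : ℤ)) : ℝ) * dz (fun w : Site (d + 1) => ((w α : ℤ) : ℝ)) β' z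
          - (Lc : ℝ)⁻¹ * (((z α % (Lc : ℤ) : ℤ)) : ℝ) * dz (fun w : Site (d + 1) => (((w β / (Lc : ℤ) : ℤ)) : ℝ)) β' z)) κ u := by
  rw [curvAdj_curv_edgePotential hLc hab]
  have e : curv (fun β' z => dz (fun w : Fin (d + 1) → ℤ => ((w β / (Lc : ℤ) : ℤ) : ℝ)) β' z
        * ((((z α / (Lc : ℤ) : ℤ) : ℝ)) + (((z + B6BondElimination.unitVec β') α / (Lc : ℤ) : ℤ) : ℝ)))
      = fun κ' l x => 2 * (((if κ' = α ∧ l = β then (1 : ℝ) else 0) - (if κ' = β ∧ l = α then (1 : ℝ) else 0))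
          * ((if x α % (Lc : ℤ) = (Lc : ℤ) - 1 then (1 : ℝ) else 0) * (if x β % (Lc : ℤ) = (Lc : ℤ) - 1 then (1 : ℝ) else 0))) := by
    funext κ' l x
    rw [curv_faceForm hab, wedge_blk_eq hLc hab]
  rw [e]
  simp only [AffineAveraging.curvAdj]
  rw [mul_add, Finset.mul_sum, Finset.mul_sum]
  congr 1 <;> exact Finset.sum_congr rfl fun l _ => by ring

/-- NOT IN PRINT; OUR BOOKKEEPING.  **THE exit⊗exit CHARGE OF THE LEVEL-0 PURE S TABLE IN THE PRODUCT CURRENCY**: `Σ'_{(x,z)} 𝟙^{exit}_α(x)𝟙^{exit}_β(z)·SpureRecAt…0 κ u x z (inl α)(inl β)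
= −(cE∕2)·((d*d)m̃_αβ)_κ(u)` (`α ≠ β`; leaf-02's iterated `tsum_exitFace_wilsonA_exitFace_eq_neg_quarter_curvAdj` + §1 + finite support). -/
theorem tsum_prod_exit_spureRecAt_zero {Lc : ℕ} [NeZero Lc] (ρ : Fin (d + 1) → ℤ) (cE cVH cΛ : ℝ) {α β : Fin (d + 1)} (hab : α ≠ β)
    (κ : Fin (d + 1)) (u : Site (d + 1)) :
    ∑' xz : Site (d + 1) × Site (d + 1), ((if xz.1 α % (Lc : ℤ) = (Lc : ℤ) - 1 then (1 : ℝ) else 0) * (if xz.2 β % (Lc : ℤ) = (Lc : ℤ) - 1 then (1 : ℝ) else 0))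
        * SpureRecAt d Lc ρ cE cVH cΛ 0 κ u xz.1 xz.2 (Sum.inl α) (Sum.inl β)
      = -(cE / 2) * curvAdj (curv (fun β' z => ((Lc : ℝ) ^ 2)⁻¹ * ((((z + unitVec β') β % (Lc : ℤ) : ℤ)) : ℝ) * dz (fun w : Site (d + 1) => ((w α : ℤ) : ℝ)) β' z
          - (Lc : ℝ)⁻¹ * (((z α % (Lc : ℤ) : ℤ)) : ℝ) * dz (fun w : Site (d + 1) => (((w β / (Lc : ℤ) : ℤ)) : ℝ)) β' z)) κ u := by
  classical
  have hLc : 1 ≤ Lc := one_le_of_neZero Lc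
  -- product sum = iterated sum (finite support of the Wilson table), then leaf-02's iterated value
  have h := hasSum_prod_of_support (F := fun x z => ((if x α % (Lc : ℤ) = (Lc : ℤ) - 1 then (1 : ℝ) else 0) * (if z β % (Lc : ℤ) = (Lc : ℤ) - 1 then (1 : ℝ) else 0))
      * (cE * wilsonA d κ u x z (Sum.inl α) (Sum.inl β)))
    ((cube (d + 1) 2).image (fun v => u + v)) ((cube (d + 1) 2).image (fun v => u + v))
    (fun x z hxz => by rw [wilsonA_inl_inl_eq_zero_of_not_mem κ u x z α β hxz, mul_zero, mul_zero])
  simp only [spureRecAt_zero_inl_inl]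
  rw [h.tsum_eq]
  -- swap the two finite-support iterated sums into leaf-02's order (`z` outside, `x` inside)
  have hs : Summable (Function.uncurry fun x z => ((if x α % (Lc : ℤ) = (Lc : ℤ) - 1 then (1 : ℝ) else 0) * (if z β % (Lc : ℤ) = (Lc : ℤ) - 1 then (1 : ℝ) else 0))
      * (cE * wilsonA d κ u x z (Sum.inl α) (Sum.inl β))) := h.summable
  rw [← hs.tsum_comm]
  have e : ∀ z, ∑' x, ((if x α % (Lc : ℤ) = (Lc : ℤ) - 1 then (1 : ℝ) else 0) * (if z β % (Lc : ℤ) = (Lc : ℤ) - 1 then (1 : ℝ) else 0))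
        * (cE * wilsonA d κ u x z (Sum.inl α) (Sum.inl β))
      = cE * ((if z β % (Lc : ℤ) = (Lc : ℤ) - 1 then (1 : ℝ) else 0)
          * ∑' x, (if x α % (Lc : ℤ) = (Lc : ℤ) - 1 then (1 : ℝ) else 0) * wilsonA d κ u x z (Sum.inl α) (Sum.inl β)) := by
    intro z
    rw [← tsum_mul_left, ← tsum_mul_left]
    exact tsum_congr fun x => by ring
  rw [tsum_congr e, tsum_mul_left, tsum_exitFace_wilsonA_exitFace_eq_neg_quarter_curvAdj hLc κ u α β,
    curvAdj_curv_faceForm_eq_two_mul hLc hab]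
  ring

/-- NOT IN PRINT; OUR BOOKKEEPING.  **THE exit⊗exit CHARGE OF THE LEVEL-0 MULTIPLIER TABLE VANISHES**: `Σ'_{(x,z)} 𝟙^{exit}_α(x)𝟙^{exit}_β(z)·M1At…0 μ w x z (inl α)(inl β) = 0`
(box root; leaf-02's `tsum_exitFace_tsum_exitFace_hessFFAt_eq_zero`, finite support). -/
theorem tsum_prod_exit_M1At_zero {Lc : ℕ} [NeZero Lc] {r : Fin (d + 1) → ℕ} (hr : r ∈ box (d + 1) Lc) (cΛ : ℝ) (α β μ : Fin (d + 1)) (w : Site (d + 1)) :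
    ∑' xz : Site (d + 1) × Site (d + 1), ((if xz.1 α % (Lc : ℤ) = (Lc : ℤ) - 1 then (1 : ℝ) else 0) * (if xz.2 β % (Lc : ℤ) = (Lc : ℤ) - 1 then (1 : ℝ) else 0))
        * M1At d Lc (toSite r) cΛ 0 μ w xz.1 xz.2 (Sum.inl α) (Sum.inl β) = 0 := by
  classical
  have hLc : 1 ≤ Lc := one_le_of_neZero Lc
  have eM : ∀ x z, M1At d Lc (toSite r) cΛ 0 μ w x z (Sum.inl α) (Sum.inl β) = (cΛ * BalabanStepW2.wM1 d Lc 0) * hessFFAt (toSite r) Lc μ w x z (Sum.inl α) (Sum.inl β) :=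
    fun x z => by simp only [M1At, Pi.smul_apply, smul_eq_mul]
  have h := hasSum_prod_of_support (F := fun x z => ((if x α % (Lc : ℤ) = (Lc : ℤ) - 1 then (1 : ℝ) else 0) * (if z β % (Lc : ℤ) = (Lc : ℤ) - 1 then (1 : ℝ) else 0))
      * ((cΛ * BalabanStepW2.wM1 d Lc 0) * hessFFAt (toSite r) Lc μ w x z (Sum.inl α) (Sum.inl β))) (nearBox Lc w) (nearBox Lc w)
    (fun x z hxz => by rw [hessFFAt_inl_inl_eq_zero_of_not_mem₂ hr μ w x z α β hxz, mul_zero, mul_zero])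
  simp only [eM]
  rw [h.tsum_eq]
  have hs : Summable (Function.uncurry fun x z => ((if x α % (Lc : ℤ) = (Lc : ℤ) - 1 then (1 : ℝ) else 0) * (if z β % (Lc : ℤ) = (Lc : ℤ) - 1 then (1 : ℝ) else 0))
      * ((cΛ * BalabanStepW2.wM1 d Lc 0) * hessFFAt (toSite r) Lc μ w x z (Sum.inl α) (Sum.inl β))) := h.summable
  rw [← hs.tsum_comm]
  have e : ∀ z, ∑' x, ((if x α % (Lc : ℤ) = (Lc : ℤ) - 1 then (1 : ℝ) else 0) * (if z β % (Lc : ℤ) = (Lc : ℤ) - 1 then (1 : ℝ) else 0))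
        * ((cΛ * BalabanStepW2.wM1 d Lc 0) * hessFFAt (toSite r) Lc μ w x z (Sum.inl α) (Sum.inl β))
      = (cΛ * BalabanStepW2.wM1 d Lc 0) * ((if z β % (Lc : ℤ) = (Lc : ℤ) - 1 then (1 : ℝ) else 0)
          * ∑' x, (if x α % (Lc : ℤ) = (Lc : ℤ) - 1 then (1 : ℝ) else 0) * hessFFAt (toSite r) Lc μ w x z (Sum.inl α) (Sum.inl β)) := by
    intro z
    rw [← tsum_mul_left, ← tsum_mul_left]
    exact tsum_congr fun x => by ring
  rw [tsum_congr e, tsum_mul_left, tsum_exitFace_tsum_exitFace_hessFFAt_eq_zero hLc hr μ w α β, mul_zero]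

/-! ## §2 (W-γ) in the exit⊗exit channel at level 0: the (γ) charge is `2cE` times the end-point (α⁺) charge -/

/-- NOT IN PRINT; OUR BOOKKEEPING.  **(W-γ), EXIT⊗EXIT CHANNEL, jb = 0, AS A THEOREM.**  In-block root `ρ = toSite r`; `G₀ = coDressKBmAt ρ Lc (KInvStep Lc 0)`, `S₀ = SpureRecAt … 0`,
`M₀ = M1At … 0`; slot `e = (ν, y′)`, label `y`; `A(e) = G₀ ∘ dM G₀ Lc S₀ M₀ ν y′` (the literal (γ) response of `GaugeReadChargeComb`); `α ≠ β`; the exit⊗exit weight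
`ω(x,z) = 𝟙^{exit}_α(x)·𝟙^{exit}_β(z)` read in the channel `(inl α, inl β)`; table charges `C_S(κ,u) = Σ'_{(x,z)} ω·S₀ κ u x z (inl α)(inl β)`, `C_M(ρ′,w)` likewise.  THEN
the (γ) ω-CHARGE of the slot — the value of leaf-06 g45's `GaugeReadChargeProfile.hasSum_weighted_gaugeSup` at `A(e)`, `gaugeWt Lc y`, `ω`:
`Σ_κ Σ'_u w_κ(u)·C_S(κ,u) + Σ_ρ′ Σ'_w w′_ρ′(w)·C_M(ρ′,w)`, `w_κ(u) = Σ'_{x₂} Σ_κ₂ A(e) u x₂ (inl κ)(inl κ₂)·gaugeWt Lc y κ₂ x₂`, `w′_ρ′(w) = Σ'_{x₂} Σ_κ₂ A(e) (Lc•w) x₂ (inr ρ′)(inl κ₂)·gaugeWt Lc y κ₂ x₂` —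
EQUALS `2·cE` TIMES the END-POINT (α⁺) ω-CHARGE of the slot in road-P2's value form (`WardResidualRotatedVertexInversion.hasSum_weighted_rotatedVertexEnd_comb`, read at level 0):
`½·(Σ_κ Σ'_u colH G₀ Lc ν y′ κ u·(½𝟙[y′ + e_ν = y] − ½𝟙[blk(u + e_κ) = y])·C_S(κ,u) + Σ_ρ′ Σ'_w colM G₀ Lc ν y′ ρ′ w·(½𝟙[y′ + e_ν = y] − ½𝟙[w + e_ρ′ = y])·C_M(ρ′,w))`.
Both sides are `(cE²∕4)·R_y(e)`, `R_y(e) = Σ'_t Σ_l 1_{B(y)}(t+e_l)·colH G₀(e) l t·((d*d)m̃_αβ)_l(t)`: the left by §1 and ENGINE (M1) (`EdgePotentialAxialGauge.gaugeRead_exitPairing_edgePotential`),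
the right by §1 and ENGINE (M2) (`EdgePotentialColumnOrthogonal.edgePotential_orthogonal_colH`); `C_M ≡ 0`.  In the joint (S)-row statement `(−½cH)·Q^γ = ε·V⁺` this is `ε = −cE·cH_0`
(`= −1` at the engine's pins `cE = Lc^{d+1}`, `cH_0 = Lc^{−(d+1)}`; ENGINE E-leaf06-g46-1 (M1)∕(M2): both reads equal `R(e)` there). -/
theorem gaugeCharge_exit_eq_two_mul_cE_mul_rotatedVertexEnd {Lc : ℕ} [NeZero Lc] {r : Fin (d + 1) → ℕ} (hr : r ∈ box (d + 1) Lc) {α β : Fin (d + 1)} (hab : α ≠ β)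
    (cE cVH cΛ : ℝ) (ν : Fin (d + 1)) (y' y : Site (d + 1)) :
    (∑ κ : Fin (d + 1), ∑' u : Site (d + 1),
        (∑' x₂, ∑ κ₂, comp (coDressKBmAt (toSite r) Lc (KInvStep (d := d) Lc 0))
            (dM (coDressKBmAt (toSite r) Lc (KInvStep (d := d) Lc 0)) Lc (SpureRecAt d Lc (toSite r) cE cVH cΛ 0) (M1At d Lc (toSite r) cΛ 0) ν y')
            u x₂ (Sum.inl κ) (Sum.inl κ₂) * gaugeWt Lc y κ₂ x₂)
          * ∑' xz : Site (d + 1) × Site (d + 1), ((if xz.1 α % (Lc : ℤ) = (Lc : ℤ) - 1 then (1 : ℝ) else 0) * (if xz.2 β % (Lc : ℤ) = (Lc : ℤ) - 1 then (1 : ℝ) else 0))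
              * SpureRecAt d Lc (toSite r) cE cVH cΛ 0 κ u xz.1 xz.2 (Sum.inl α) (Sum.inl β)
      + ∑ ρ' : Fin (d + 1), ∑' w : Site (d + 1),
        (∑' x₂, ∑ κ₂, comp (coDressKBmAt (toSite r) Lc (KInvStep (d := d) Lc 0))
            (dM (coDressKBmAt (toSite r) Lc (KInvStep (d := d) Lc 0)) Lc (SpureRecAt d Lc (toSite r) cE cVH cΛ 0) (M1At d Lc (toSite r) cΛ 0) ν y')
            ((Lc : ℤ) • w) x₂ (Sum.inr ρ') (Sum.inl κ₂) * gaugeWt Lc y κ₂ x₂)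
          * ∑' xz : Site (d + 1) × Site (d + 1), ((if xz.1 α % (Lc : ℤ) = (Lc : ℤ) - 1 then (1 : ℝ) else 0) * (if xz.2 β % (Lc : ℤ) = (Lc : ℤ) - 1 then (1 : ℝ) else 0))
              * M1At d Lc (toSite r) cΛ 0 ρ' w xz.1 xz.2 (Sum.inl α) (Sum.inl β))
      = 2 * cE * ((1 / 2 : ℝ) *
        ((∑ κ : Fin (d + 1), ∑' u : Site (d + 1),
            colH (coDressKBmAt (toSite r) Lc (KInvStep (d := d) Lc 0)) Lc ν y' κ u
              * ((if y' + Pi.single ν 1 = y then (1 / 2 : ℝ) else 0) - (if blk Lc (u + Pi.single κ 1) = y then (1 / 2 : ℝ) else 0))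
              * ∑' xz : Site (d + 1) × Site (d + 1), ((if xz.1 α % (Lc : ℤ) = (Lc : ℤ) - 1 then (1 : ℝ) else 0) * (if xz.2 β % (Lc : ℤ) = (Lc : ℤ) - 1 then (1 : ℝ) else 0))
                  * SpureRecAt d Lc (toSite r) cE cVH cΛ 0 κ u xz.1 xz.2 (Sum.inl α) (Sum.inl β))
          + ∑ ρ' : Fin (d + 1), ∑' w : Site (d + 1),
            colM (coDressKBmAt (toSite r) Lc (KInvStep (d := d) Lc 0)) Lc ν y' ρ' w
              * ((if y' + Pi.single ν 1 = y then (1 / 2 : ℝ) else 0) - (if w + Pi.single ρ' 1 = y then (1 / 2 : ℝ) else 0))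
              * ∑' xz : Site (d + 1) × Site (d + 1), ((if xz.1 α % (Lc : ℤ) = (Lc : ℤ) - 1 then (1 : ℝ) else 0) * (if xz.2 β % (Lc : ℤ) = (Lc : ℤ) - 1 then (1 : ℝ) else 0))
                  * M1At d Lc (toSite r) cΛ 0 ρ' w xz.1 xz.2 (Sum.inl α) (Sum.inl β))) := by
  classical
  have hLc : 1 ≤ Lc := one_le_of_neZero Lc
  -- the table charges in closed form
  simp only [tsum_prod_exit_spureRecAt_zero (toSite r) cE cVH cΛ hab, tsum_prod_exit_M1At_zero hr cΛ α β, mul_zero, tsum_zero,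
    Finset.sum_const_zero, add_zero]
  -- (M1): the (γ) read of the edge potential's `d*d`
  have hM1 := gaugeRead_exitPairing_edgePotential hr hab cE cVH cΛ ν y' y
  -- (M2): it is orthogonal to the column
  have hM2 := edgePotential_orthogonal_colH hLc hr hab ν y'
  -- abbreviations
  set G := coDressKBmAt (toSite r) Lc (KInvStep (d := d) Lc 0) with hG
  set D : Form1 (d + 1) ℝ := curvAdj (curv (fun β' z => ((Lc : ℝ) ^ 2)⁻¹ * ((((z + unitVec β') β % (Lc : ℤ) : ℤ)) : ℝ) * dz (fun w : Site (d + 1) => ((w α : ℤ) : ℝ)) β' z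
          - (Lc : ℝ)⁻¹ * (((z α % (Lc : ℤ) : ℤ)) : ℝ) * dz (fun w : Site (d + 1) => (((w β / (Lc : ℤ) : ℤ)) : ℝ)) β' z)) with hD
  set c₁ : ℝ := (if y' + Pi.single ν 1 = y then (1 / 2 : ℝ) else 0) with hc₁
  set χ : Fin (d + 1) → Site (d + 1) → ℝ := fun κ u => if blk Lc (u + Pi.single κ 1) = y then (1 / 2 : ℝ) else 0 with hχ
  set T : ℝ := ∑' t, ∑ l, (if blk Lc (t + unitVec l) = y then (1 : ℝ) else 0) * colH G Lc ν y' l t * D l t with hT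
  -- bounds and summabilities
  have hDb : ∀ κ u, |D κ u| ≤ (d + 1 : ℕ) * (2 * (4 * (1 : ℝ))) + (d + 1 : ℕ) * (2 * (4 * (1 : ℝ))) :=
    fun κ u => abs_curvAdj_curv_le (fun κ u => abs_edgePotential_le_one hLc hab κ u) κ u
  obtain ⟨δG, CG, hδG, hCG, hGd⟩ := decays_coDressKBmAt_KInvStep (d := d) hr 0
  have hGK : ∃ δ C : ℝ, 0 < δ ∧ 0 ≤ C ∧ Decays G C δ := ⟨δG, CG, hδG, hCG, hGd⟩
  obtain ⟨CA, Cs, CM, δ, hδ, hA, -, -⟩ := exists_vertexFamily_combResponse (d := d) (Lc := Lc) hLc hr cE cVH cΛ 0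
  have hw : ∀ κ u, |∑' x₂, ∑ κ₂, comp G (dM G Lc (SpureRecAt d Lc (toSite r) cE cVH cΛ 0) (M1At d Lc (toSite r) cΛ 0) ν y') u x₂ (Sum.inl κ) (Sum.inl κ₂) * gaugeWt Lc y κ₂ x₂|
      ≤ ((d + 1 : ℕ) * CA * Zl (d + 1) δ) * Real.exp (-δ * l1 (u - (Lc : ℤ) • y')) :=
    fun κ u => abs_read_le (hA ν y') hδ (fun κ₂ x₂ => abs_gaugeWt_le_one Lc y κ₂ x₂) u (Sum.inl κ)
  have hsw : ∀ κ, Summable fun u => (∑' x₂, ∑ κ₂, comp G (dM G Lc (SpureRecAt d Lc (toSite r) cE cVH cΛ 0) (M1At d Lc (toSite r) cΛ 0) ν y') u x₂ (Sum.inl κ) (Sum.inl κ₂)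
      * gaugeWt Lc y κ₂ x₂) * (-(cE / 2) * D κ u) := by
    intro κ
    refine Summable.of_norm_bounded ((((summable_exp_shift' hδ ((Lc : ℤ) • y')).mul_left ((d + 1 : ℕ) * CA * Zl (d + 1) δ)).mul_right
      (|cE / 2| * ((d + 1 : ℕ) * (2 * (4 * (1 : ℝ))) + (d + 1 : ℕ) * (2 * (4 * (1 : ℝ))))))) (fun u => ?_)
    rw [Real.norm_eq_abs, abs_mul, abs_mul, abs_neg]
    exact mul_le_mul (hw κ u) (mul_le_mul_of_nonneg_left (hDb κ u) (abs_nonneg _)) (by positivity) ((abs_nonneg _).trans (hw κ u))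
  -- LEFT: `Σ_κ Σ'_u w_κ(u)·(−(cE/2)·D κ u) = −(cE/2)·(Σ'_u Σ_κ D κ u·w_κ u) = −(cE/2)·(−(cE/2)·R)`
  have hL : (∑ κ : Fin (d + 1), ∑' u : Site (d + 1),
        (∑' x₂, ∑ κ₂, comp G (dM G Lc (SpureRecAt d Lc (toSite r) cE cVH cΛ 0) (M1At d Lc (toSite r) cΛ 0) ν y') u x₂ (Sum.inl κ) (Sum.inl κ₂) * gaugeWt Lc y κ₂ x₂)
          * (-(cE / 2) * D κ u))
      = -(cE / 2) * ∑' u, ∑ κ, D κ u * (∑' x₂, ∑ κ₂, comp G (dM G Lc (SpureRecAt d Lc (toSite r) cE cVH cΛ 0) (M1At d Lc (toSite r) cΛ 0) ν y')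
          u x₂ (Sum.inl κ) (Sum.inl κ₂) * gaugeWt Lc y κ₂ x₂) := by
    rw [← Summable.tsum_finsetSum (fun κ _ => hsw κ), ← tsum_mul_left]
    refine tsum_congr fun u => ?_
    rw [Finset.mul_sum]
    exact Finset.sum_congr rfl fun κ _ => by ring
  rw [hL, hM1]
  -- RIGHT: the end-point weight splits into the slot-constant half (killed by (M2)) and the block half (`= R/2`)
  have hs1 : ∀ κ, Summable fun u : Site (d + 1) => colH G Lc ν y' κ u * D κ u :=
    fun κ => summable_colH_mul_bdd (N := Lc) hGK (hDb κ) ν y' κ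
  have hχb : ∀ κ u, |χ κ u * D κ u| ≤ (1 / 2 : ℝ) * ((d + 1 : ℕ) * (2 * (4 * (1 : ℝ))) + (d + 1 : ℕ) * (2 * (4 * (1 : ℝ)))) := fun κ u => by
    rw [abs_mul]
    refine mul_le_mul ?_ (hDb κ u) (abs_nonneg _) (by norm_num)
    show |(if blk Lc (u + Pi.single κ 1) = y then (1 / 2 : ℝ) else 0)| ≤ 1 / 2
    split_ifs <;> norm_num
  have hs2 : ∀ κ, Summable fun u : Site (d + 1) => colH G Lc ν y' κ u * (χ κ u * D κ u) :=
    fun κ => summable_colH_mul_bdd (N := Lc) hGK (hχb κ) ν y' κ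
  have hS1 : Summable fun u : Site (d + 1) => ∑ κ, D κ u * colH G Lc ν y' κ u :=
    summable_sum fun κ _ => (hs1 κ).congr fun u => mul_comm _ _
  have hS2 : Summable fun u : Site (d + 1) => ∑ κ, colH G Lc ν y' κ u * (χ κ u * D κ u) := summable_sum fun κ _ => hs2 κ
  -- (M2) as a `HasSum` with value `0`
  have H1 : HasSum (fun u : Site (d + 1) => ∑ κ, D κ u * colH G Lc ν y' κ u) 0 := hS1.hasSum_iff.mpr hM2
  -- the block half: `Σ' Σ colH·χ·D = T/2`
  have eχ : ∀ (l : Fin (d + 1)) (t : Site (d + 1)), χ l t = (1 / 2 : ℝ) * (if blk Lc (t + unitVec l) = y then (1 : ℝ) else 0) := fun l t => by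
    show (if blk Lc (t + Pi.single l 1) = y then (1 / 2 : ℝ) else 0) = (1 / 2 : ℝ) * (if blk Lc (t + unitVec l) = y then (1 : ℝ) else 0)
    rw [show unitVec l = Pi.single l 1 from rfl]; split_ifs <;> norm_num
  have hR : (∑' u : Site (d + 1), ∑ κ : Fin (d + 1), colH G Lc ν y' κ u * (χ κ u * D κ u)) = (1 / 2 : ℝ) * T := by
    show _ = (1 / 2 : ℝ) * ∑' t, ∑ l, (if blk Lc (t + unitVec l) = y then (1 : ℝ) else 0) * colH G Lc ν y' l t * D l t
    rw [← tsum_mul_left]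
    refine tsum_congr fun t => ?_
    rw [Finset.mul_sum]
    refine Finset.sum_congr rfl fun l _ => ?_
    rw [eχ l t]
    ring
  have H2 : HasSum (fun u : Site (d + 1) => ∑ κ, colH G Lc ν y' κ u * (χ κ u * D κ u)) ((1 / 2 : ℝ) * T) := hS2.hasSum_iff.mpr hR
  -- assemble: per-κ summability of the displayed summand, and the two-piece `HasSum` of its κ-sum
  have hB : ∀ κ : Fin (d + 1), Summable fun u : Site (d + 1) => colH G Lc ν y' κ u * (c₁ - χ κ u) * (-(cE / 2) * D κ u) :=
    fun κ => (((hs1 κ).mul_left (-(cE / 2) * c₁)).add ((hs2 κ).mul_left (cE / 2))).congr fun u => by ring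
  have hfun : (fun u : Site (d + 1) => ∑ κ : Fin (d + 1), colH G Lc ν y' κ u * (c₁ - χ κ u) * (-(cE / 2) * D κ u))
      = fun u : Site (d + 1) => -(cE / 2) * c₁ * (∑ κ, D κ u * colH G Lc ν y' κ u) + (cE / 2) * (∑ κ, colH G Lc ν y' κ u * (χ κ u * D κ u)) := by
    funext u
    rw [Finset.mul_sum, Finset.mul_sum, ← Finset.sum_add_distrib]
    exact Finset.sum_congr rfl fun κ _ => by ring
  have hA : HasSum (fun u : Site (d + 1) => ∑ κ : Fin (d + 1), colH G Lc ν y' κ u * (c₁ - χ κ u) * (-(cE / 2) * D κ u))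
      (-(cE / 2) * c₁ * 0 + (cE / 2) * ((1 / 2 : ℝ) * T)) := by
    rw [hfun]
    exact (H1.mul_left (-(cE / 2) * c₁)).add (H2.mul_left (cE / 2))
  have hV : (∑ κ : Fin (d + 1), ∑' u : Site (d + 1), colH G Lc ν y' κ u * (c₁ - χ κ u) * (-(cE / 2) * D κ u))
      = -(cE / 2) * c₁ * 0 + (cE / 2) * ((1 / 2 : ℝ) * T) :=
    (hasSum_sum fun κ _ => (hB κ).hasSum).unique hA
  have final : 2 * cE * ((1 / 2 : ℝ) * ∑ κ : Fin (d + 1), ∑' u : Site (d + 1), colH G Lc ν y' κ u * (c₁ - χ κ u) * (-(cE / 2) * D κ u))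
      = -(cE / 2) * (-(cE / 2) * T) := by
    rw [hV]; ring
  exact final.symm

/-! ## §3 (M1) ⨾ (M2) at level 0 in road-P2's `ChargeTowerExitOrthogonal` §2 shape: the exit⊗exit charge function of `S₀` reads zero through every `ℋ`-column of `G₀` -/

/-- NOT IN PRINT; OUR BOOKKEEPING.  **EXIT⊗EXIT ORTHOGONALITY AT LEVEL 0** (in-block root, `α ≠ β`, all `cE cVH cΛ`, every slot `(ν,y′)`):
`Σ'_u Σ_κ C_S(κ,u)·colH G₀ Lc ν y′ κ u = 0` — §1 `tsum_prod_exit_spureRecAt_zero` ⨾ g46 (M2) `EdgePotentialColumnOrthogonal.edgePotential_orthogonal_colH`.  The `j+1 ≥ 1` levels are road-P2 g42's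
`ChargeTowerExitOrthogonal.tsum_sum_exitCharge_mul_colH_eq_zero` (same shape with `KInvStep Lc (j+1)`, `SpureRecAt … (j+1)`); together: every level. -/
theorem tsum_sum_exitCharge_mul_colH_eq_zero_levelZero {Lc : ℕ} [NeZero Lc] {r : Fin (d + 1) → ℕ} (hr : r ∈ box (d + 1) Lc) (cE cVH cΛ : ℝ) {α β : Fin (d + 1)} (hαβ : α ≠ β)
    (ν : Fin (d + 1)) (y' : Site (d + 1)) :
    ∑' u, ∑ κ, (∑' xz : Site (d + 1) × Site (d + 1),
        (if xz.1 α % (Lc : ℤ) = (Lc : ℤ) - 1 then (1 : ℝ) else 0) * (if xz.2 β % (Lc : ℤ) = (Lc : ℤ) - 1 then (1 : ℝ) else 0)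
          * SpureRecAt d Lc (toSite r) cE cVH cΛ 0 κ u xz.1 xz.2 (Sum.inl α) (Sum.inl β))
        * colH (coDressKBmAt (toSite r) Lc (KInvStep (d := d) Lc 0)) Lc ν y' κ u = 0 := by
  have hLc : 1 ≤ Lc := one_le_of_neZero Lc
  have hM2 := edgePotential_orthogonal_colH hLc hr hαβ ν y'
  simp only [tsum_prod_exit_spureRecAt_zero (toSite r) cE cVH cΛ hαβ]
  calc
    ∑' u, ∑ κ, -(cE / 2) * curvAdj (curv (fun β' z => ((Lc : ℝ) ^ 2)⁻¹ * ((((z + unitVec β') β % (Lc : ℤ) : ℤ)) : ℝ) * dz (fun w : Site (d + 1) => ((w α : ℤ) : ℝ)) β' z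
            - (Lc : ℝ)⁻¹ * (((z α % (Lc : ℤ) : ℤ)) : ℝ) * dz (fun w : Site (d + 1) => (((w β / (Lc : ℤ) : ℤ)) : ℝ)) β' z)) κ u
          * colH (coDressKBmAt (toSite r) Lc (KInvStep (d := d) Lc 0)) Lc ν y' κ u
        = -(cE / 2) * ∑' u, ∑ κ, curvAdj (curv (fun β' z => ((Lc : ℝ) ^ 2)⁻¹ * ((((z + unitVec β') β % (Lc : ℤ) : ℤ)) : ℝ) * dz (fun w : Fin (d + 1) → ℤ => ((w α : ℤ) : ℝ)) β' z
            - (Lc : ℝ)⁻¹ * (((z α % (Lc : ℤ) : ℤ)) : ℝ) * dz (fun w : Fin (d + 1) → ℤ => (((w β / (Lc : ℤ) : ℤ)) : ℝ)) β' z)) κ u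
          * colH (coDressKBmAt (toSite r) Lc (KInvStep (d := d) Lc 0)) Lc ν y' κ u := by
      rw [← tsum_mul_left]
      refine tsum_congr fun u => ?_
      rw [Finset.mul_sum]
      exact Finset.sum_congr rfl fun κ _ => by ring
    _ = 0 := by rw [hM2, mul_zero]

/-- NOT IN PRINT; OUR BOOKKEEPING.  The same with the finite sum outside: `Σ_κ Σ'_u colH G₀ Lc ν y′ κ u·C_S(κ,u) = 0` (summability of each `u ↦ colH·C_S` from an2's `summable_colH_mul_bdd`,
`|C_S| ≤ |cE∕2|·16(d+1)` by §1, g46 `abs_edgePotential_le_one` and FILE A `abs_curvAdj_curv_le`). -/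
theorem sum_tsum_colH_mul_exitCharge_eq_zero_levelZero {Lc : ℕ} [NeZero Lc] {r : Fin (d + 1) → ℕ} (hr : r ∈ box (d + 1) Lc) (cE cVH cΛ : ℝ) {α β : Fin (d + 1)} (hαβ : α ≠ β)
    (ν : Fin (d + 1)) (y' : Site (d + 1)) :
    ∑ κ, ∑' u, colH (coDressKBmAt (toSite r) Lc (KInvStep (d := d) Lc 0)) Lc ν y' κ u
        * (∑' xz : Site (d + 1) × Site (d + 1),
          (if xz.1 α % (Lc : ℤ) = (Lc : ℤ) - 1 then (1 : ℝ) else 0) * (if xz.2 β % (Lc : ℤ) = (Lc : ℤ) - 1 then (1 : ℝ) else 0)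
            * SpureRecAt d Lc (toSite r) cE cVH cΛ 0 κ u xz.1 xz.2 (Sum.inl α) (Sum.inl β)) = 0 := by
  have hLc : 1 ≤ Lc := one_le_of_neZero Lc
  obtain ⟨δG, CG, hδG, hCG, hGd⟩ := decays_coDressKBmAt_KInvStep (d := d) hr 0
  have hGK : ∃ δ C : ℝ, 0 < δ ∧ 0 ≤ C ∧ Decays (coDressKBmAt (toSite r) Lc (KInvStep (d := d) Lc 0)) C δ := ⟨δG, CG, hδG, hCG, hGd⟩
  have hCb : ∀ (κ : Fin (d + 1)) (u : Site (d + 1)), |∑' xz : Site (d + 1) × Site (d + 1),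
      (if xz.1 α % (Lc : ℤ) = (Lc : ℤ) - 1 then (1 : ℝ) else 0) * (if xz.2 β % (Lc : ℤ) = (Lc : ℤ) - 1 then (1 : ℝ) else 0)
        * SpureRecAt d Lc (toSite r) cE cVH cΛ 0 κ u xz.1 xz.2 (Sum.inl α) (Sum.inl β)|
      ≤ |cE / 2| * ((d + 1 : ℕ) * (2 * (4 * (1 : ℝ))) + (d + 1 : ℕ) * (2 * (4 * (1 : ℝ)))) := fun κ u => by
    rw [tsum_prod_exit_spureRecAt_zero (toSite r) cE cVH cΛ hαβ, abs_mul, abs_neg]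
    exact mul_le_mul_of_nonneg_left (abs_curvAdj_curv_le (fun κ u => abs_edgePotential_le_one hLc hαβ κ u) κ u) (abs_nonneg _)
  rw [← Summable.tsum_finsetSum (fun κ _ => summable_colH_mul_bdd (N := Lc) hGK (hCb κ) ν y' κ)]
  calc
    ∑' u, ∑ κ ∈ Finset.univ, colH (coDressKBmAt (toSite r) Lc (KInvStep (d := d) Lc 0)) Lc ν y' κ u
          * (∑' xz : Site (d + 1) × Site (d + 1),
            (if xz.1 α % (Lc : ℤ) = (Lc : ℤ) - 1 then (1 : ℝ) else 0) * (if xz.2 β % (Lc : ℤ) = (Lc : ℤ) - 1 then (1 : ℝ) else 0)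
              * SpureRecAt d Lc (toSite r) cE cVH cΛ 0 κ u xz.1 xz.2 (Sum.inl α) (Sum.inl β))
        = ∑' u, ∑ κ, (∑' xz : Site (d + 1) × Site (d + 1),
            (if xz.1 α % (Lc : ℤ) = (Lc : ℤ) - 1 then (1 : ℝ) else 0) * (if xz.2 β % (Lc : ℤ) = (Lc : ℤ) - 1 then (1 : ℝ) else 0)
              * SpureRecAt d Lc (toSite r) cE cVH cΛ 0 κ u xz.1 xz.2 (Sum.inl α) (Sum.inl β))
          * colH (coDressKBmAt (toSite r) Lc (KInvStep (d := d) Lc 0)) Lc ν y' κ u :=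
      tsum_congr fun u => Finset.sum_congr rfl fun κ _ => mul_comm _ _
    _ = 0 := tsum_sum_exitCharge_mul_colH_eq_zero_levelZero hr cE cVH cΛ hαβ ν y'

end Summit.QuantumFields.BalabanUV.Beta.GAN24.GaugeReadExitWard

end
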